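import Summits.QuantumFields.YangMills.Theorems.LangevinControlUVOSLegsFromFemtoAndGapDefs
import Literature.MathematicalPhysics.QuantumFieldTheory.GaugeOSData
import HarnessLib

/-!
# The volume-free (infinite-volume) forms of the plane-resolved E0′ ceilings `MomentBounds6` — definitions

HONEST FRAMING (R136 (i) «parallel continuum programme», seat `ym-infvol-p1`, pre-birth vocabulary for the
infinite-volume ∕ continuum-from-UV route; bears on the spine route `BalabanLadder`, crux `UVSeamRec` =
stmt-QuantumFields-20043, whose conclusion is `MomentBounds6 G r uRec`, and on its leaf `UV` = stmt-QuantumFields-19351).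
DEFINITIONS ONLY, nothing asserted: each `def … : Prop` below is the infinite-volume READING of the tree's collar
output `DlrCollarTransfer.MomentBounds6` — a statement a route item or a registered stub proves or consumes, not a
literature fact and not a restatement of any crux as a claim.  Conditional currency: `MomentBounds6` is what Track A's
UV leg owes (E0′, unprinted; barrier `UVStabilityNonUniqueness`); existence half of the continuum programme only; not
a gap, not Clay.

WHY.  `MomentBounds6 G r a` (Theorems/LangevinControlUVOSLegsFromFemtoAndGapDefs §3) bounds the centred mixed moments
of strings of single-plane plaquette fields under the PERIODIC odd-torus Wilson states,
`|⟨∏ᵢ (Pᵢ − ⟨Pᵢ⟩)⟩_{β,2L+1}| ≤ (C/R⁴)ⁿ` at pairwise torus sup-separation `≥ 2R+4`, collar `R·a(β) ≤ ℓ₄`, with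
`C, β₄, ℓ₄` fixed BEFORE the torus (`4R+8 ≤ L` is its only volume clause): uniform in the volume, but a statement
about torus STATES.  A route that takes the thermodynamic limit `L → ∞` at fixed coupling first and the continuum
limit second reads the same inequality in STATES ON `ℤ⁴` (tree `LGConfig 4 G`), with the integer sup-separation in
place of the cyclic one and no volume parameter at all.  This file names that reading once, parametrically in the
family of states, and its three specialisations; the theorems about them (torus form ⇒ thermodynamic-limit form = the
landed `InfiniteVolume.momentBounds6_infiniteVolume` of seat p2 read through these names, DLR ⇒ IV ⇒ TL, unit
transfer, the spine corollary from `UV ∧ UVSeamRec`, the `ℤ⁴`-DLR collar from `FBL6`) live in the companion proof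
files `BalabanLadderInfVolCeilings*.lean`.

* `stateMomentStr G r μ n q x` — `∫ ∏ᵢ (P^{qᵢ}_{xᵢ} − ∫ P^{qᵢ}_{xᵢ} dμ) dμ`, the centred mixed moment of a plane string
  in a state `μ` on `ℤ⁴` gauge fields (`P^q_x = DlrCollarTransfer.plane G r q x`).
* `MomentBounds6On G r a S` — the volume-free ceiling for a `β`-indexed family of states `S β`.
* `MomentBounds6TL G r a` — `S β = oddTorusLimitPoints r β` (tree `GaugeOSData`): the odd-torus thermodynamic limit
  states, i.e. the states the torus-projective family produces (seat p2's compactness step); VERBATIM the conclusion of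
  `InfiniteVolume.momentBounds6_infiniteVolume` once `stateMomentStr` is unfolded (design handshake of record).
* `MomentBounds6IV G r a` — `S β = infiniteVolumeLimitPoints r.ρ β` (tree `LatticeGaugeDLR`): all torus limit states.
* `MomentBounds6DLR G r a` — `S β = ymGibbsMeasures r.ρ β`: every DLR state of the lattice Yang–Mills specification —
  the strongest volume-free form, the one the frozen-boundary law `FBL6` yields through the `ℤ⁴` DLR equations.

References: E. Seiler, LNP 159 (1982) Ch. 2; H.-O. Georgii, Gibbs Measures and Phase Transitions (2011) Def. 1.23,
Thm. 4.17; A. Jaffe, E. Witten, Quantum Yang–Mills theory (2006) §5–§6 («uniform in the volume»); tree files above.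
-/

set_option autoImplicit false

noncomputable section

open MeasureTheory
open scoped BigOperators
open Literature.MathematicalPhysics.QuantumFieldTheory Literature.MathematicalPhysics.QuantumLattice
open Summit.QuantumFields.YangMills.Cruxes.OSLegsFromFemtoAndGap.DlrCollarTransfer

namespace Summit.QuantumFields.YangMills.Theorems.InfiniteVolume

variable (G : Type) [Group G] [TopologicalSpace G] [IsTopologicalGroup G] [CompactSpace G]
  [MeasurableSpace G] [BorelSpace G] (r : LatticeRep G) (a : ℝ → ℝ)

/-- **Centred mixed moment of a plane string in a state.**  For a measure `μ` on `ℤ⁴` gauge fields, orientations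
`q i` and sites `x i`: `∫ ∏ᵢ (P^{qᵢ}_{xᵢ} − ∫ P^{qᵢ}_{xᵢ} dμ) dμ` with `P^q_x = plane G r q x` the single-plane plaquette
field `Re tr r.ρ(U_p)` of orientation `q` based at `x` — the quantity `MomentBounds6` bounds under the odd-torus
states (`torusE`), read in an arbitrary state. -/
def stateMomentStr (μ : Measure (LGConfig 4 G)) (n : ℕ) (q : Fin n → Fin 4 × Fin 4)
    (x : Fin n → (Fin 4 → ℤ)) : ℝ :=
  ∫ U, ∏ i, (plane G r (q i) (x i) U - ∫ V, plane G r (q i) (x i) V ∂μ) ∂μ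

/-- **`MomentBounds6On G r a S` — the volume-free (infinite-volume) form of `MomentBounds6` for a `β`-indexed family
of states `S β` on `ℤ⁴` gauge fields.**  There are `C ≥ 0`, `β₄` and `ℓ₄ > 0` such that for all `β ≥ β₄`, every
state `μ ∈ S β`, every plane string `(q, x)` with `(q i).1 < (q i).2`, and every collar radius `R ≥ 1` with
`R·a(β) ≤ ℓ₄` and pairwise `ℤ⁴` sup-separation `2R+4 ≤ |xᵢ k − xⱼ k|` in some coordinate `k`,
`|stateMomentStr G r μ n q x| ≤ (C/R⁴)ⁿ`.  Verbatim the inner inequality of `DlrCollarTransfer.MomentBounds6` with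
the torus expectation replaced by `μ` and the cyclic separation by the integer one; no volume parameter is left. -/
def MomentBounds6On (S : ℝ → Set (Measure (LGConfig 4 G))) : Prop :=
  ∃ (C β₄ ℓ₄ : ℝ), 0 < ℓ₄ ∧ 0 ≤ C ∧ ∀ β : ℝ, β₄ ≤ β → ∀ μ ∈ S β,
    ∀ (n : ℕ) (q : Fin n → Fin 4 × Fin 4) (x : Fin n → (Fin 4 → ℤ)) (R : ℕ), (∀ i, (q i).1 < (q i).2) →
      1 ≤ R → (R : ℝ) * a β ≤ ℓ₄ →
      (∀ i j : Fin n, i ≠ j → ∃ k : Fin 4, (2 * (R : ℤ) + 4) ≤ |x i k - x j k|) →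
      |stateMomentStr G r μ n q x| ≤ (C / (R : ℝ) ^ 4) ^ n

/-- **`MomentBounds6TL` — the ceilings for the ODD-TORUS THERMODYNAMIC LIMIT STATES** `oddTorusLimitPoints r β`
(limits, on bounded continuous cylinder observables, of the periodic Wilson states on `(ℤ/(2S_k+1))⁴` along
`S_k ↑ ∞`): the form an infinite-volume route built on the torus-projective family consumes.  With `stateMomentStr`
unfolded this is character-for-character the conclusion of `InfiniteVolume.momentBounds6_infiniteVolume`
(Theorems/InfiniteVolumeMomentBounds.lean), which derives it from `MomentBounds6 G r a` with the same constants. -/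
def MomentBounds6TL : Prop :=
  MomentBounds6On G r a (oddTorusLimitPoints r)

/-- **`MomentBounds6IV` — the ceilings for ALL TORUS LIMIT STATES** `infiniteVolumeLimitPoints r.ρ β` (limits along
any strictly increasing sequence of torus sides `L_k + 1`, the tree's canonical thermodynamic limit points, odd or
even).  Not implied by `MomentBounds6` (which speaks of odd tori only); implied by the DLR form. -/
def MomentBounds6IV : Prop :=
  MomentBounds6On G r a (infiniteVolumeLimitPoints (d := 4) r.ρ)

/-- **`MomentBounds6DLR` — the ceilings for EVERY INFINITE-VOLUME DLR STATE** of the lattice Yang–Mills specification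
at coupling `β` (`ymGibbsMeasures r.ρ β`, Georgii Def. 1.23): the strongest volume-free form — it covers the torus
limit states (Georgii Thm. 4.17, tree `mem_ymGibbsMeasures_of_mem_infiniteVolumeLimitPoints_holds`) and the limits of
any other boundary conditions — and the one the plane-resolved frozen-boundary law `DlrCollarTransfer.FBL6` yields
directly: the collar mechanism (conditional independence of separated cubes given their exteriors, kernel means
pinned to `C₁/d⁴`) is a statement about the local DLR kernels and sees no volume. -/
def MomentBounds6DLR : Prop :=
  MomentBounds6On G r a (ymGibbsMeasures (d := 4) r.ρ)

/-- `MomentBounds6TL` unfolded to the shape of `InfiniteVolume.momentBounds6_infiniteVolume` (design handshake with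
seat p2: the two texts agree definitionally). [folklore] -/
theorem momentBounds6TL_iff :
    MomentBounds6TL G r a ↔
      ∃ (C β₄ ℓ₄ : ℝ), 0 < ℓ₄ ∧ 0 ≤ C ∧ ∀ β : ℝ, β₄ ≤ β →
        ∀ μ ∈ oddTorusLimitPoints r β,
        ∀ (n : ℕ) (q : Fin n → Fin 4 × Fin 4) (x : Fin n → (Fin 4 → ℤ)) (R : ℕ), (∀ i, (q i).1 < (q i).2) →
          1 ≤ R → (R : ℝ) * a β ≤ ℓ₄ →
          (∀ i j : Fin n, i ≠ j → ∃ k : Fin 4, (2 * (R : ℤ) + 4) ≤ |x i k - x j k|) →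
          |∫ U, ∏ i, (plane G r (q i) (x i) U - ∫ V, plane G r (q i) (x i) V ∂μ) ∂μ| ≤ (C / (R : ℝ) ^ 4) ^ n :=
  Iff.rfl

/-- `MomentBounds6DLR` unfolded: the DLR condition is `IsGibbsMeasure (ymSpecification r.ρ β) μ`. [folklore] -/
theorem momentBounds6DLR_iff :
    MomentBounds6DLR G r a ↔
      ∃ (C β₄ ℓ₄ : ℝ), 0 < ℓ₄ ∧ 0 ≤ C ∧ ∀ β : ℝ, β₄ ≤ β → ∀ μ : Measure (LGConfig 4 G),
        Literature.Probability.LatticeModels.IsGibbsMeasure (ymSpecification (d := 4) r.ρ β) μ →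
        ∀ (n : ℕ) (q : Fin n → Fin 4 × Fin 4) (x : Fin n → (Fin 4 → ℤ)) (R : ℕ), (∀ i, (q i).1 < (q i).2) →
          1 ≤ R → (R : ℝ) * a β ≤ ℓ₄ →
          (∀ i j : Fin n, i ≠ j → ∃ k : Fin 4, (2 * (R : ℤ) + 4) ≤ |x i k - x j k|) →
          |stateMomentStr G r μ n q x| ≤ (C / (R : ℝ) ^ 4) ^ n :=
  Iff.rfl

end Summit.QuantumFields.YangMills.Theorems.InfiniteVolume

end
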